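import Mathlib.Probability.CDF
import Mathlib.MeasureTheory.Measure.Lebesgue.Basic
import HarnessLib

/-!
# Quantile coupling: a bounded random variable as an antitone function on `(0, 1)`

Probability/Distributions support file (everything proved; no definitions, no named facts).

The *decreasing rearrangement* (quantile transform) of a real random variable. Main result
`exists_antitone_map_volume_Ioo_eq_map`: if `q : α → ℝ` is measurable and bounded on a probability
space `(α, ν)`, there is an antitone bounded `h : ℝ → ℝ` whose law under Lebesgue measure on the
unit interval is the law of `q`,

  `(volume.restrict (Ioo 0 1)).map h = ν.map q`.

Construction. Let `ρ = ν.map q` and `F = cdf ρ` (Mathlib's `ProbabilityTheory.cdf`, a Stieltjes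
function). The lower quantile `Q p = sInf {x | p ≤ F x}` has the Galois property
`Q p ≤ b ↔ p ≤ F b` for `p ∈ (0, 1)` (`sInf_setOf_le_cdf_le_iff`; the infimum is attained by
right-continuity of `F`). Hence for any `h` agreeing with `a ↦ Q (1 - a)` on `(0, 1)` the set
`{a ∈ (0, 1) | h a ≤ b}` is an interval of length `F b`, so the law of `h` and `ρ` agree on all rays
`Iic b` and are equal (`map_volume_Ioo_eq_of_forall_le_iff_le_cdf`, via `Measure.ext_of_Iic`).
When `ρ` is carried by `[-C, C]`, clamping the level sets to `[-C, C]` (`insert C (… ∩ Ici (-C))`)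
gives a version of `a ↦ Q (1 - a)` that is antitone on all of `ℝ` with values in `[-C, C]`
(`exists_antitone_abs_le_eqOn_sInf_setOf_le_cdf`,
`exists_antitone_map_volume_Ioo_eq_of_measure_Icc`).

This is the rearrangement step in R. Bamler's proof of the sharp `L²`-bound for `∇K/K`
(2020a, §4.3, proof of Prop. 4.2), where `q = ∂ᵥK/K` and `h` is its decreasing rearrangement.

What is NOT here: uniqueness of the rearrangement, the unbounded (integrable) case,
equimeasurability statements beyond equality of laws, and anything about heat kernels.

## References

* R. H. Bamler, *Entropy and heat kernel bounds on a Ricci flow background*, arXiv:2008.07093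
  (2020), §4.3. [Bamler2020Entropy]

Folklore (quantile transform / Skorokhod representation on the unit interval).
-/

noncomputable section

namespace Literature.Probability.Distributions

open Set Filter _root_.MeasureTheory _root_.ProbabilityTheory
open scoped _root_.Topology

/-- **Galois property of the lower quantile.** For a measure `ρ` on `ℝ` with distribution function
`cdf ρ` and a level `p ∈ (0, 1)`, the lower quantile `sInf {x | p ≤ cdf ρ x}` satisfies
`sInf {x | p ≤ cdf ρ x} ≤ b ↔ p ≤ cdf ρ b`. The level set is nonempty and bounded below because
`cdf ρ` tends to `1` at `+∞` and to `0` at `-∞`, and it contains its infimum by right-continuity.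
[folklore] -/
theorem sInf_setOf_le_cdf_le_iff (ρ : Measure ℝ) {p : ℝ} (hp₀ : 0 < p) (hp₁ : p < 1) (b : ℝ) :
    sInf {x : ℝ | p ≤ cdf ρ x} ≤ b ↔ p ≤ cdf ρ b := by
  set S : Set ℝ := {x : ℝ | p ≤ cdf ρ x}
  have hne : S.Nonempty := ((tendsto_cdf_atTop ρ).eventually_const_le hp₁).exists
  obtain ⟨B, hB⟩ : ∃ B, ∀ x ≤ B, cdf ρ x < p :=
    eventually_atBot.1 ((tendsto_cdf_atBot ρ).eventually_lt_const hp₀)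
  have hbdd : BddBelow S := ⟨B, fun x hx => le_of_not_gt fun hxB => (hB x hxB.le).not_ge hx⟩
  refine ⟨fun h => ?_, fun h => csInf_le hbdd h⟩
  -- the infimum belongs to `S`, by right-continuity of the cdf
  have hmem : p ≤ cdf ρ (sInf S) := by
    have htend : Tendsto (cdf ρ) (𝓝[>] sInf S) (𝓝 (cdf ρ (sInf S))) :=
      ((cdf ρ).right_continuous (sInf S)).mono Ioi_subset_Ici_self
    refine ge_of_tendsto htend (eventually_nhdsWithin_of_forall fun x hx => ?_)
    obtain ⟨y, hyS, hyx⟩ := exists_lt_of_csInf_lt hne hx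
    exact hyS.trans ((cdf ρ).mono hyx.le)
  exact hmem.trans ((cdf ρ).mono h)

/-- **The quantile transform has the right law.** Let `ρ` be a probability measure on `ℝ` and let
`Q` have the Galois property of its quantile, `Q p ≤ b ↔ p ≤ cdf ρ b` for `p ∈ (0, 1)`. If a
measurable `h : ℝ → ℝ` agrees with `a ↦ Q (1 - a)` on `(0, 1)`, then the law of `h` under Lebesgue
measure on `(0, 1)` is `ρ`: both give mass `cdf ρ b` to every ray `Iic b`. [folklore] -/
theorem map_volume_Ioo_eq_of_forall_le_iff_le_cdf (ρ : Measure ℝ) [IsProbabilityMeasure ρ]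
    {Q h : ℝ → ℝ} (hQ : ∀ p ∈ Ioo (0 : ℝ) 1, ∀ b, Q p ≤ b ↔ p ≤ cdf ρ b) (hh : Measurable h)
    (hhQ : ∀ a ∈ Ioo (0 : ℝ) 1, h a = Q (1 - a)) :
    (volume.restrict (Ioo (0 : ℝ) 1)).map h = ρ := by
  refine Measure.ext_of_Iic _ _ fun b => ?_
  rw [Measure.map_apply hh measurableSet_Iic, Measure.restrict_apply (hh measurableSet_Iic),
    ← ofReal_cdf ρ b]
  have hpre : h ⁻¹' Iic b ∩ Ioo 0 1 = Ici (1 - cdf ρ b) ∩ Ioo 0 1 := by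
    ext a
    simp only [mem_inter_iff, mem_preimage, mem_Iic, mem_Ici]
    constructor
    · rintro ⟨hab, ha⟩
      rw [hhQ a ha, hQ (1 - a) ⟨by linarith [ha.2], by linarith [ha.1]⟩] at hab
      exact ⟨by linarith, ha⟩
    · rintro ⟨hab, ha⟩
      refine ⟨?_, ha⟩
      rw [hhQ a ha, hQ (1 - a) ⟨by linarith [ha.2], by linarith [ha.1]⟩]
      linarith
  rw [hpre]
  refine le_antisymm ?_ ?_
  · calc volume (Ici (1 - cdf ρ b) ∩ Ioo 0 1) ≤ volume (Icc (1 - cdf ρ b) 1) :=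
          measure_mono fun a ha => ⟨ha.1, ha.2.2.le⟩
      _ = ENNReal.ofReal (cdf ρ b) := by rw [Real.volume_Icc, sub_sub_cancel]
  · calc ENNReal.ofReal (cdf ρ b) = volume (Ioo (1 - cdf ρ b) 1) := by
          rw [Real.volume_Ioo, sub_sub_cancel]
      _ ≤ volume (Ici (1 - cdf ρ b) ∩ Ioo 0 1) :=
          measure_mono fun a ha => ⟨ha.1.le, by linarith [ha.1, cdf_le_one ρ b], ha.2⟩

/-- **Decreasing rearrangement, bounded case.** For a probability measure `ρ` on `ℝ` carried by
`[-C, C]` there is an antitone `h : ℝ → ℝ` with `|h| ≤ C` which on `(0, 1)` is the lower quantile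
of `ρ` at level `1 - a`, `h a = sInf {x | 1 - a ≤ cdf ρ x}`. (Take the infimum of the level set
clamped to `[-C, C]`, `insert C ({x | 1 - a ≤ cdf ρ x} ∩ Ici (-C))`, which is antitone in `a` on all
of `ℝ`.) [folklore] -/
theorem exists_antitone_abs_le_eqOn_sInf_setOf_le_cdf (ρ : Measure ℝ) [IsProbabilityMeasure ρ]
    {C : ℝ} (hC : ρ (Icc (-C) C) = 1) :
    ∃ h : ℝ → ℝ, Antitone h ∧ (∀ a, |h a| ≤ C) ∧
      ∀ a ∈ Ioo (0 : ℝ) 1, h a = sInf {x : ℝ | 1 - a ≤ cdf ρ x} := by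
  have hC₀ : 0 ≤ C := by
    by_contra hlt
    rw [Icc_eq_empty_of_lt (by linarith [not_le.mp hlt]), measure_empty] at hC
    exact zero_ne_one hC
  have hcdfC : cdf ρ C = 1 := by
    have h1 : ρ (Iic C) = 1 :=
      le_antisymm prob_le_one (hC.symm.le.trans (measure_mono Icc_subset_Iic_self))
    simpa [h1] using ofReal_cdf ρ C
  have hcdf_lt : ∀ x < -C, cdf ρ x = 0 := by
    intro x hx
    have h0 : ρ (Iic x) = 0 := by
      have hcompl : ρ (Icc (-C) C)ᶜ = 0 := (prob_compl_eq_zero_iff measurableSet_Icc).2 hC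
      refine measure_mono_null (fun y hy => ?_) hcompl
      rw [mem_compl_iff, mem_Icc]
      rintro ⟨hy1, -⟩
      have hyx : y ≤ x := hy
      linarith
    have h2 := ofReal_cdf ρ x
    rw [h0, ENNReal.ofReal_eq_zero] at h2
    exact le_antisymm h2 (cdf_nonneg ρ x)
  -- the level sets of the cdf, clamped to `[-C, C]`
  set T : ℝ → Set ℝ := fun p => insert C ({x : ℝ | p ≤ cdf ρ x} ∩ Ici (-C)) with hT
  have hTne : ∀ p, (T p).Nonempty := fun p => ⟨C, mem_insert _ _⟩
  have hTlb : ∀ p, ∀ x ∈ T p, -C ≤ x := by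
    rintro p x (rfl | ⟨-, hx⟩)
    · linarith
    · exact hx
  have hTbdd : ∀ p, BddBelow (T p) := fun p => ⟨-C, hTlb p⟩
  have hTanti : ∀ ⦃p p' : ℝ⦄, p ≤ p' → T p' ⊆ T p := by
    rintro p p' hpp' x (rfl | ⟨hx, hx'⟩)
    · exact mem_insert _ _
    · exact mem_insert_of_mem _ ⟨hpp'.trans hx, hx'⟩
  -- on `(0, 1]` the clamping is ineffective
  have hTS : ∀ p, 0 < p → p ≤ 1 → T p = {x : ℝ | p ≤ cdf ρ x} := by
    intro p hp₀ hp₁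
    apply subset_antisymm
    · rintro x (rfl | ⟨hx, -⟩)
      · exact hp₁.trans hcdfC.ge
      · exact hx
    · intro x hx
      have hx' : p ≤ cdf ρ x := hx
      refine mem_insert_of_mem _ ⟨hx, mem_Ici.2 (le_of_not_gt fun hxC => ?_)⟩
      rw [hcdf_lt x hxC] at hx'
      exact hx'.not_gt hp₀
  refine ⟨fun a => sInf (T (1 - a)),
    fun a b hab => csInf_le_csInf (hTbdd _) (hTne _) (hTanti (by linarith)),
    fun a => abs_le.2 ⟨le_csInf (hTne _) (hTlb _), csInf_le (hTbdd _) (mem_insert _ _)⟩,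
    fun a ha => ?_⟩
  show sInf (T (1 - a)) = _
  rw [hTS (1 - a) (by linarith [ha.2]) (by linarith [ha.1])]

/-- **Decreasing rearrangement of a compactly supported law.** A probability measure `ρ` on `ℝ`
carried by `[-C, C]` is the law, under Lebesgue measure on `(0, 1)`, of an antitone function
`h : ℝ → ℝ` with `|h| ≤ C`. [folklore] -/
theorem exists_antitone_map_volume_Ioo_eq_of_measure_Icc (ρ : Measure ℝ) [IsProbabilityMeasure ρ]
    {C : ℝ} (hC : ρ (Icc (-C) C) = 1) :
    ∃ h : ℝ → ℝ, Antitone h ∧ (∀ a, |h a| ≤ C) ∧ (volume.restrict (Ioo (0 : ℝ) 1)).map h = ρ := by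
  obtain ⟨h, hanti, hle, hh⟩ := exists_antitone_abs_le_eqOn_sInf_setOf_le_cdf ρ hC
  exact ⟨h, hanti, hle, map_volume_Ioo_eq_of_forall_le_iff_le_cdf ρ
    (Q := fun p => sInf {x : ℝ | p ≤ cdf ρ x})
    (fun p hp b => sInf_setOf_le_cdf_le_iff ρ hp.1 hp.2 b) hanti.measurable hh⟩

/-- **Quantile coupling (decreasing rearrangement) of a bounded random variable.** If `q` is a
bounded measurable real function on a probability space `(α, ν)`, there is an antitone bounded
`h : ℝ → ℝ` on the unit interval with the same law: `(volume.restrict (Ioo 0 1)).map h = ν.map q`.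
This is the rearrangement `h` of `q = ∂ᵥK/K` used by Bamler (2020a, §4.3, proof of Prop. 4.2).
[folklore] -/
theorem exists_antitone_map_volume_Ioo_eq_map {α : Type*} [MeasurableSpace α] (ν : Measure α)
    [IsProbabilityMeasure ν] {q : α → ℝ} (hq : Measurable q) (hbdd : ∃ C : ℝ, ∀ y, |q y| ≤ C) :
    ∃ h : ℝ → ℝ, Antitone h ∧ (∃ C : ℝ, ∀ a, |h a| ≤ C) ∧
      (volume.restrict (Ioo (0 : ℝ) 1)).map h = ν.map q := by
  obtain ⟨C, hC⟩ := hbdd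
  haveI : IsProbabilityMeasure (ν.map q) := Measure.isProbabilityMeasure_map hq.aemeasurable
  have hsupp : ν.map q (Icc (-C) C) = 1 := by
    rw [Measure.map_apply hq measurableSet_Icc,
      eq_univ_of_forall (s := q ⁻¹' Icc (-C) C) fun y => abs_le.1 (hC y), measure_univ]
  obtain ⟨h, hanti, hle, hmap⟩ := exists_antitone_map_volume_Ioo_eq_of_measure_Icc (ν.map q) hsupp
  exact ⟨h, hanti, ⟨C, hle⟩, hmap⟩

end Literature.Probability.Distributions
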